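import Summits.QuantumFields.YangMills.Theorems.UnitScaleTiltProp7TubeComparisonKnit
import Summits.QuantumFields.YangMills.Theorems.UnitScaleTiltProp7TubeStrSubStairLineIter
import Summits.QuantumFields.YangMills.Theorems.UnitScaleTiltProp7TrueLinIterDefectOfStairGauge
import Summits.QuantumFields.YangMills.Theorems.UnitScaleTiltProp7CoarseGaugeEqFrameResponseQTwS
import Summits.QuantumFields.YangMills.Theorems.UnitScaleTiltProp7TransverseRowOfTubeRowRegPr
import HarnessLib

/-!
# Route `UnitScaleTilt`, crux «MinimiserStabilityRegPr» (stmt-QuantumFields-19200, stub EX), positivity block, pen (b) —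
# ★★★ THE INSTANTIATION: `hQcmp` (CT = 4, `Cq = 10¹¹L¹⁰`) FOR EVERY CARRIER AT EVERY PRINTED-REGULAR BACKGROUND, NO SUPPLIER ROW LEFT

Cell `ym3-torus` (rung R3 — YM₃ on T³; NOT d = 4, NOT the Clay problem).  Width seat `ym-routeR-w4` g25, pen handed over by the (b) holder w7-19200 g10 (HOME STATUS 2026-08-29 22:25:49Z:
«the INSTANTIATION file … the letters are yours»).  THEOREMS ONLY (0 `def`, 0 `sorry`); `--supports stmt-QuantumFields-19200 --as helper`; count-neutral.

THE POINT.  The knit door ✓`Prop7TubeComparisonKnit.tubeRowC_of_su2Rows` (p748250) turns three 𝔰𝔲(2) supplier rows — (R1) the tower-vs-corner row with a unitary frame, (R2) the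
DEFECT row `S ≈ G`, (R3) the identity `QTwS W A = G A ∘ bondShift` — into the tube-comparison row `hQcmp` with `CT = 4`.  All three rows are now NAMED theorems of the tree:
(R1) = ✓`Prop7TubeStrSubStairLineIter.sum_frob_tubeStr_sub_smul_conjR_lineIter_le` (p748544, `E₁ = 2·10⁹L⁴ε₀²ℓ^dℓ²`), (R2) = ✓`Prop7TrueLinIterDefectOfStairGauge.
sqrt_sum_normSq_frameReduced_sub_lineIter_le_of_regPr` (p746096) at `k = K − n`, squared and read in Frobenius letters, (R3) = ✓`Prop7CoarseGaugeEqFrameResponseQTwS.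
QTwS_apply_eq_frameReduced_bondShift` (px13 g11, p748472's companion).  The ONE plumbing point: the suppliers take the pure `LINE` family `S`, the true-linearisation family `Q`
and the stair-mean coarse gauges `Λ` as HYPOTHESIS-BOUND recursions; here they are supplied as `Nat.rec` terms (`S`, `Q`: the recursion rows hold by `rfl`) and by
✓`exists_stairGauge_family` (`Λ`, via `choose`), so NO recursion row surfaces.  The knit's slack constant `(8(ℓ^d)²E₂ + 8E₁)∕(ε₀²ℓ^dℓ²)` is bounded by the CLOSED, LEVEL-UNIFORM
`Cq := 10¹¹·L¹⁰` (at `d = 3`: `ρ² = L⁻¹`, `ρ^{2(K−n)} = ℓ⁻¹`, `κ² = 159²·25·36·L⁵`, `B = 25L²ε₀∕16`, `e^{2κB∕ρ} ≤ e ≤ 3` under `10¹⁰L⁶ε₀ ≤ 1`).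
HONEST SCOPE.  Plumbing + one numeric comparison; no estimate of print beyond the cited rows as landed.  The `hT` binder follows by ✓`Prop7TransverseRowOfTubeRowRegPr.hT_of_tubeRowC`
(its window `16·Cq·ε₀² ≤ 1` holds under `10¹⁰L⁶ε₀ ≤ 1`, proved here as `sixteen_mul_Cq_mul_sq_le_one`); `hGF`, the print rows, `hThm2S`, EX `stub_existenceMinimalOrbit` and the crux
`MinimiserStabilityRegPr` are NOT proved here.
References: T. Bałaban, CMP **98** (1985) 17–51 [Balaban1985Averaging] (Prop. 2 (53) p.26, Prop. 3 (124)–(126) p.36, Prop. 4 (134)–(135) p.38); CMP **95** (1984) 17–40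
[Balaban1984PropagatorsI] ((1.18)–(1.20) pp.19–20); CMP **99** (1985) 389–434 [Balaban1985BackgroundPropagators] (Thm 3.11 p.416, (3.118)–(3.122)); CMP **102** (1985) 277–309
[Balaban1985Variational] ((51) p.286).
-/

set_option autoImplicit false

noncomputable section

open scoped BigOperators Matrix.Norms.L2Operator Matrix InnerProductSpace

namespace Summit.QuantumFields.YangMills.Theorems.Prop7TubeComparisonKnitOfRegPr

open Literature.MathematicalPhysics.QuantumFieldTheory.Balaban1983to89
open Literature.MathematicalPhysics.QuantumFieldTheory.Balaban1983to89.T3ContinuumYM3Torus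
open Finset T4Continuum BlockAveraging AveragingRT ExpMeanLog BlockAveragingEMLLinearised BlockAveragingEMLLinearisedBackground BlockAveragingEMLProp2
open B1RG242Torus
open B7Prop1Explicit (treeWord expUnit)
open B7Prop2Explicit (unitaryUnits)
open B7Eq78Linearization (conjR)
open B10Eq27TorusAxialLog (holT unitsField toUField axialT)
open B15DeterminingSets (embIter)
open T3LevelShift (bondShift)
open T3PrintedRegularOrbits (sites_eq)
open T3PrintedRegularMinimiser (RegPr)
open T3SectALandauChart (bgUnits)
open Summit.QuantumFields.YangMills.Theorems.Prop8Chart (emlIterU)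
open B11Eq103H1Complex (BondL2K)
open Summit.QuantumFields.YangMills.Theorems.Prop7SectET3Transport (periodsT3)
open Summit.QuantumFields.YangMills.Theorems.Prop7SectET3HilbertLetters (W₂ frobEquiv DstarL2)
open Summit.QuantumFields.YangMills.Theorems.Prop7SectET3WilsonHessian (DeltaEta)
open Summit.QuantumFields.YangMills.Theorems.Prop7SectET3CurvedPropagators (Qk)
open Summit.QuantumFields.YangMills.Theorems.Prop7TransverseRowOfTubeRowRegPr (hT_of_tubeRowC)
open Summit.QuantumFields.YangMills.Theorems.Prop7SymAvgTwSym (QTwS)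
open Summit.QuantumFields.YangMills.Theorems.Prop7SkewSplitOpNormRow (sum_opNorm_sq_le_sum_frob sum_frob_le_two_mul_sum_opNorm_sq)
open Summit.QuantumFields.YangMills.Theorems.Prop7TubeComparisonKnit (tubeRowC_of_su2Rows)
open Summit.QuantumFields.YangMills.Theorems.Prop7TubeStrSubStairLineIter (sum_frob_tubeStr_sub_smul_conjR_lineIter_le axialT_bg_mem_unitaryUnits)
open Summit.QuantumFields.YangMills.Theorems.Prop7TrueLinIterDefectOfStairGauge (sqrt_sum_normSq_frameReduced_sub_lineIter_le_of_regPr)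
open Summit.QuantumFields.YangMills.Theorems.Prop7CoarseGaugeEqFrameResponseQTwS (exists_stairGauge_family QTwS_apply_eq_frameReduced_bondShift)

variable (F : T3Family) (n K : ℕ)

/-! ## §1 The numeric comparison `(8(ℓ^d)²E₂ + 8E₁)∕(ε₀²ℓ^dℓ²) ≤ 10¹¹L¹⁰` -/

set_option maxHeartbeats 400000 in
/-- **THE BRIDGE CONSTANT, SQUARED AND LEVEL-FREE** (d = 3, `ℓ′ = 5L`): with `ρ = √((L^d)⁻¹L²)`, `κ = 159ℓ′√(2d·L^d·2d)`, `B = ℓ′²ε₀∕16` and `10¹⁰L⁶ε₀ ≤ 1`: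
`16·(ℓ^d)²·(ρ⁻¹·ρ^{K−n}·κBe^{κB∕ρ})² ≤ (10¹¹L¹⁰ − 16·10⁹L⁴)·ε₀²·(ℓ^d·ℓ²)` (`ρ² = L⁻¹`, `(ρ²)^{K−n}·ℓ^d = ℓ²` at `d = 3`, `κ²B² = 159²·900·(25∕16)²·L⁹ε₀²`, `e^{2κB∕ρ} ≤ 3`).
[cite: Balaban1985Averaging, Prop. 3 (124)-(126) p.36; Balaban1984PropagatorsI, (1.20) p.20] -/
theorem bridgeConst_sq_le {ε₀ : ℝ} (hε₀ : 0 < ε₀) (hε : 10 ^ 10 * (F.L : ℝ) ^ 6 * ε₀ ≤ 1) :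
    16 * (((F.L : ℝ) ^ (K - n)) ^ (F.P K).d) ^ 2
        * ((Real.sqrt ((((F.P K).L : ℝ) ^ (F.P K).d)⁻¹ * ((F.P K).L : ℝ) ^ 2))⁻¹ * (Real.sqrt ((((F.P K).L : ℝ) ^ (F.P K).d)⁻¹ * ((F.P K).L : ℝ) ^ 2) ^ (K - n)
            * (159 * ((((F.P K).d + 2) * (F.P K).L : ℕ) : ℝ) * Real.sqrt (2 * (F.P K).d * ((F.P K).L : ℝ) ^ (F.P K).d * (2 * (F.P K).d))) * (((((F.P K).d + 2) * (F.P K).L : ℕ) : ℝ) ^ 2 / 16 * ε₀)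
              * Real.exp ((159 * ((((F.P K).d + 2) * (F.P K).L : ℕ) : ℝ) * Real.sqrt (2 * (F.P K).d * ((F.P K).L : ℝ) ^ (F.P K).d * (2 * (F.P K).d))) / Real.sqrt ((((F.P K).L : ℝ) ^ (F.P K).d)⁻¹ * ((F.P K).L : ℝ) ^ 2) * (((((F.P K).d + 2) * (F.P K).L : ℕ) : ℝ) ^ 2 / 16 * ε₀)))) ^ 2
      ≤ (10 ^ 11 * (F.L : ℝ) ^ 10 - 16 * 10 ^ 9 * (F.L : ℝ) ^ 4) * (ε₀ ^ 2 * ((((F.L : ℝ) ^ (K - n)) ^ (F.P K).d) * ((F.L : ℝ) ^ (K - n)) ^ 2)) := by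
  have hd : (F.P K).d = 3 := T3Family.P_d F K
  have hLL : ((F.P K).L : ℝ) = F.L := rfl
  have hL3 : (3 : ℝ) ≤ F.L := by
    have h3 : 3 ≤ F.L := by obtain ⟨a, ha⟩ := F.hL.1; have := F.hL.2; omega
    exact_mod_cast h3
  have hL0 : (0 : ℝ) < F.L := by linarith
  have hℓp : ((((F.P K).d + 2) * (F.P K).L : ℕ) : ℝ) = 5 * (F.L : ℝ) := by rw [hd, ← hLL]; push_cast; ring
  rw [hℓp, hd, hLL]
  -- the letters at `d = 3`
  set L : ℝ := (F.L : ℝ) with hLdef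
  set ℓ : ℝ := L ^ (K - n) with hℓ
  have hℓ0 : 0 < ℓ := by rw [hℓ]; positivity
  have hρ2 : (L ^ 3)⁻¹ * L ^ 2 = L⁻¹ := by field_simp
  rw [hρ2]
  set ρ : ℝ := Real.sqrt L⁻¹ with hρ
  have hρ0 : 0 < ρ := by rw [hρ]; exact Real.sqrt_pos.mpr (inv_pos.mpr hL0)
  have hρsq : ρ ^ 2 = L⁻¹ := by rw [hρ]; exact Real.sq_sqrt (inv_nonneg.mpr hL0.le)
  have hρk : (ρ ^ (K - n)) ^ 2 * ℓ = 1 := by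
    rw [← pow_mul, mul_comm (K - n) 2, pow_mul, hρsq, hℓ, ← mul_pow, inv_mul_cancel₀ hL0.ne', one_pow]
  -- `κ² = 159²·25·36·L⁵`
  have h36 : Real.sqrt (2 * (3 : ℕ) * L ^ (3 : ℕ) * (2 * (3 : ℕ))) ^ 2 = 36 * L ^ 3 := by
    rw [Real.sq_sqrt (by positivity)]; push_cast; ring
  set s : ℝ := Real.sqrt (2 * (3 : ℕ) * L ^ (3 : ℕ) * (2 * (3 : ℕ))) with hs
  have hs0 : 0 ≤ s := Real.sqrt_nonneg _
  -- the exponent is tiny: `x = κB∕ρ`, `x² = κ²B²L ≤ 10⁻¹²`, so `e^{2x} ≤ e ≤ 3`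
  set x : ℝ := 159 * (5 * L) * s / ρ * ((5 * L) ^ 2 / 16 * ε₀) with hx
  have hx0 : 0 ≤ x := by rw [hx]; positivity
  have hxsq : x ^ 2 = (159 * (5 * L)) ^ 2 * (36 * L ^ 3) * L * ((5 * L) ^ 2 / 16 * ε₀) ^ 2 := by
    rw [hx, div_mul_eq_mul_div, div_pow, mul_pow, mul_pow, h36]
    have : ρ ^ 2 ≠ 0 := by positivity
    field_simp
    rw [hρsq]; field_simp
  have hL6 : L ^ 6 * ε₀ ≤ ((10 : ℝ) ^ 10)⁻¹ := by
    have : (10 : ℝ) ^ 10 * (L ^ 6 * ε₀) ≤ 1 := by rw [← mul_assoc]; exact hε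
    rw [inv_eq_one_div, le_div_iff₀ (by norm_num)]; linarith
  have hx2le : x ^ 2 ≤ (1 / 2) ^ 2 := by
    rw [hxsq]
    have h1 : (159 * (5 * L)) ^ 2 * (36 * L ^ 3) * L * ((5 * L) ^ 2 / 16 * ε₀) ^ 2 = (159 ^ 2 * 25 * 36 * (625 / 256)) * (L ^ 6 * ε₀) ^ 2 / L ^ 2 := by
      field_simp; ring
    rw [h1, div_le_iff₀ (by positivity)]
    have h2 : (L ^ 6 * ε₀) ^ 2 ≤ (((10 : ℝ) ^ 10)⁻¹) ^ 2 := pow_le_pow_left₀ (by positivity) hL6 2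
    have h3 : (1 : ℝ) ≤ L ^ 2 := one_le_pow₀ (by linarith)
    norm_num at h2 ⊢
    nlinarith [h2, h3]
  have hxle : x ≤ 1 / 2 := (pow_le_pow_iff_left₀ hx0 (by norm_num) two_ne_zero).mp hx2le
  have hexp : Real.exp x ^ 2 ≤ 3 := by
    rw [← Real.exp_nat_mul]; push_cast
    calc Real.exp (2 * x) ≤ Real.exp 1 := Real.exp_le_exp.mpr (by linarith)
      _ ≤ 3 := by have := Real.exp_one_lt_d9; linarith
  -- assemble: the left side is `16·ℓ^6·ρ⁻²·(ρ^{K−n})²·κ²B²·e^{2x} = 16·L·ℓ⁵·κ²B²·e^{2x}`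
  have hlhs : 16 * (ℓ ^ (3 : ℕ)) ^ 2 * (ρ⁻¹ * (ρ ^ (K - n) * (159 * (5 * L) * s) * ((5 * L) ^ 2 / 16 * ε₀) * Real.exp x)) ^ 2
      = 16 * L * (ℓ ^ 3 * ℓ ^ 2) * ((159 * (5 * L)) ^ 2 * (36 * L ^ 3) * ((5 * L) ^ 2 / 16 * ε₀) ^ 2) * Real.exp x ^ 2 := by
    have e1 : (ℓ ^ (3 : ℕ)) ^ 2 = (ℓ ^ 3 * ℓ ^ 2) * ℓ := by ring
    have e2 : (ρ⁻¹ * (ρ ^ (K - n) * (159 * (5 * L) * s) * ((5 * L) ^ 2 / 16 * ε₀) * Real.exp x)) ^ 2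
        = (ρ ^ 2)⁻¹ * (ρ ^ (K - n)) ^ 2 * ((159 * (5 * L)) ^ 2 * s ^ 2 * ((5 * L) ^ 2 / 16 * ε₀) ^ 2) * Real.exp x ^ 2 := by
      have hρne : ρ ≠ 0 := hρ0.ne'
      field_simp
    rw [e1, e2, h36, hρsq, inv_inv]
    have : (ρ ^ (K - n)) ^ 2 = ℓ⁻¹ := eq_inv_of_mul_eq_one_left hρk
    rw [this]; field_simp
  rw [hlhs]
  -- numerics: `16·L·κ²B²∕ε₀²·3 = 16·159²·900·(625∕256)·3·L¹⁰ ≤ 10¹¹L¹⁰ − 16·10⁹L⁴`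
  have hL1 : (1 : ℝ) ≤ L := by linarith
  have hL4 : L ^ 4 ≤ L ^ 10 := pow_le_pow_right₀ hL1 (by norm_num)
  have hK0 : 0 ≤ 16 * L * (ℓ ^ 3 * ℓ ^ 2) * ((159 * (5 * L)) ^ 2 * (36 * L ^ 3) * ((5 * L) ^ 2 / 16 * ε₀) ^ 2) := by positivity
  calc 16 * L * (ℓ ^ 3 * ℓ ^ 2) * ((159 * (5 * L)) ^ 2 * (36 * L ^ 3) * ((5 * L) ^ 2 / 16 * ε₀) ^ 2) * Real.exp x ^ 2
      ≤ 16 * L * (ℓ ^ 3 * ℓ ^ 2) * ((159 * (5 * L)) ^ 2 * (36 * L ^ 3) * ((5 * L) ^ 2 / 16 * ε₀) ^ 2) * 3 := mul_le_mul_of_nonneg_left hexp hK0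
    _ = (16 * 159 ^ 2 * 900 * (625 / 256) * 3) * L ^ 10 * (ε₀ ^ 2 * (ℓ ^ 3 * ℓ ^ 2)) := by ring
    _ ≤ (10 ^ 11 * L ^ 10 - 16 * 10 ^ 9 * L ^ 4) * (ε₀ ^ 2 * (ℓ ^ 3 * ℓ ^ 2)) := by
        refine mul_le_mul_of_nonneg_right ?_ (by positivity)
        nlinarith [hL4, pow_nonneg hL0.le 10]

/-- The `hT` window of ✓`Prop7TransverseRowOfTubeRowRegPr.hT_of_tubeRowC` for `Cq = 10¹¹L¹⁰`: `16·(10¹¹L¹⁰)·ε₀² ≤ 1` under `10¹⁰L⁶ε₀ ≤ 1` (`L ≥ 3`).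
[cite: Balaban1985BackgroundPropagators, Thm 3.11 p.416] -/
theorem sixteen_mul_Cq_mul_sq_le_one {ε₀ : ℝ} (hε₀ : 0 < ε₀) (hε : 10 ^ 10 * (F.L : ℝ) ^ 6 * ε₀ ≤ 1) :
    16 * (10 ^ 11 * (F.L : ℝ) ^ 10) * ε₀ ^ 2 ≤ 1 := by
  have hL3 : (3 : ℝ) ≤ F.L := by
    have h3 : 3 ≤ F.L := by obtain ⟨a, ha⟩ := F.hL.1; have := F.hL.2; omega
    exact_mod_cast h3
  have hL1 : (1 : ℝ) ≤ (F.L : ℝ) ^ 2 := one_le_pow₀ (by linarith)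
  have h1 : (F.L : ℝ) ^ 6 * ε₀ ≤ ((10 : ℝ) ^ 10)⁻¹ := by
    have : (10 : ℝ) ^ 10 * ((F.L : ℝ) ^ 6 * ε₀) ≤ 1 := by rw [← mul_assoc]; exact hε
    rw [inv_eq_one_div, le_div_iff₀ (by norm_num)]; linarith
  have h2 : ((F.L : ℝ) ^ 6 * ε₀) ^ 2 ≤ (((10 : ℝ) ^ 10)⁻¹) ^ 2 := pow_le_pow_left₀ (by positivity) h1 2
  have h3 : 16 * (10 ^ 11 * (F.L : ℝ) ^ 10) * ε₀ ^ 2 * (F.L : ℝ) ^ 2 = 16 * 10 ^ 11 * ((F.L : ℝ) ^ 6 * ε₀) ^ 2 := by ring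
  have h4 : 16 * (10 ^ 11 * (F.L : ℝ) ^ 10) * ε₀ ^ 2 ≤ 16 * (10 ^ 11 * (F.L : ℝ) ^ 10) * ε₀ ^ 2 * (F.L : ℝ) ^ 2 :=
    le_mul_of_one_le_right (by positivity) hL1
  norm_num at h2
  nlinarith [h2, h3, h4]

variable (h : n ≤ K)

/-! ## §2 ★★★ `hQcmp` at every printed-regular background -/


/-- ★★★ **`hQcmp` (CT = 4, `Cq = 10¹¹L¹⁰`) FOR EVERY CARRIER AT A PRINTED-REGULAR BACKGROUND.**  For `RegPr F n K ε₀ W`, `10¹⁰L⁶ε₀ ≤ 1`, `10¹²L³ε₀ ≤ 1` and EVERY bond field `X`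
(`ℓ = L^{K−n}`): `Σ_c ‖T^{str}_W X(c)‖² ≤ 4·(ℓ^d)²·Σ_{c'} ‖QTwS W X c'‖² + 10¹¹L¹⁰·ε₀²·(ℓ^d·ℓ²)·Σ_b ‖X b‖²` — the `hQcmp` binder of
✓`Prop7TransverseRowOfTubeRowRegPr.hT_of_tubeRowC` ∕ ✓`…transverseRow_of_tubeRowC`.  PROOF = the knit ✓`tubeRowC_of_su2Rows` with `S A := ` the pure `LINE` iterate (a `Nat.rec`,
recursion rows by `rfl`), `G A := ` the frame-reduced response along the stair-mean coarse gauge `Λ_A` of ✓`exists_stairGauge_family`, `Φ c := axialT W♭ x₀(c) (embIter (K−n) c₋)`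
(`hΦ` = ✓`axialT_bg_mem_unitaryUnits`), (R1) = ✓`sum_frob_tubeStr_sub_smul_conjR_lineIter_le`, (R2) = ✓`sqrt_sum_normSq_frameReduced_sub_lineIter_le_of_regPr` at `k = K − n`
squared (`E₂ = 2(ρ⁻¹ρ^{K−n}κBe^{κB∕ρ})²`) in Frobenius letters (✓`sum_frob_le_two_mul_sum_opNorm_sq`, ✓`sum_opNorm_sq_le_sum_frob`), (R3) = ✓`QTwS_apply_eq_frameReduced_bondShift`
(true-linearisation family `Q` as a `Nat.rec`); the slack by §1.
[cite: Balaban1984PropagatorsI, (1.18)-(1.20) pp.19-20; Balaban1985Averaging, Prop. 3 (124)-(126) p.36, Prop. 4 (134)-(135) p.38; Balaban1985BackgroundPropagators, (3.13)-(3.15) p.393, Thm 3.11 p.416; Balaban1985Variational, (51) p.286] -/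
theorem tubeRowC_of_regPr {ε₀ : ℝ} (hε₀ : 0 < ε₀) (hε : 10 ^ 10 * (F.L : ℝ) ^ 6 * ε₀ ≤ 1) (hε12 : 10 ^ 12 * (F.L : ℝ) ^ 3 * ε₀ ≤ 1)
    (W : GaugeField (F.P K) 0 (Matrix.specialUnitaryGroup (Fin 2) ℂ)) (hreg : RegPr F n K ε₀ W)
    (X : PBond (F.P K) 0 → Matrix (Fin 2) (Fin 2) ℂ) :
    ∑ c : PBond (F.P K) (K - n), ‖∑ r : Fin (F.P K).d → Fin ((F.P K).L ^ (K - n)), ∑ t ∈ range ((F.P K).L ^ (K - n)),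
        conjR (holT (unitsField (toUField W)) (Site.fibreSite 0 (K - n) c.src fun _ => ⟨0, pow_pos (F.P K).L_pos (K - n)⟩)
              (treeWord fun ν => ((r ν : ℕ) : ℤ))
            * holT (unitsField (toUField W)) (Site.fibreSite 0 (K - n) c.src r) (List.replicate t (c.dir, true)))
          (X ⟨(fun z : Site (F.P K) 0 => z.shift c.dir)^[t] (Site.fibreSite 0 (K - n) c.src r), c.dir⟩)‖ ^ 2
      ≤ 4 * (((F.L : ℝ) ^ (K - n)) ^ (F.P K).d) ^ 2 * ∑ c' : PBond (F.P n) 0, ‖QTwS F n K h W X c'‖ ^ 2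
        + (10 ^ 11 * (F.L : ℝ) ^ 10) * ε₀ ^ 2 * ((((F.L : ℝ) ^ (K - n)) ^ (F.P K).d) * ((F.L : ℝ) ^ (K - n)) ^ 2) * ∑ b : PBond (F.P K) 0, ‖X b‖ ^ 2 := by
  classical
  have hL3 : (3 : ℝ) ≤ F.L := by
    have h3 : 3 ≤ F.L := by obtain ⟨a, ha⟩ := F.hL.1; have := F.hL.2; omega
    exact_mod_cast h3
  have hL0 : (0 : ℝ) < F.L := by linarith
  have hℓd0 : (0 : ℝ) < ((F.L : ℝ) ^ (K - n)) ^ (F.P K).d := by positivity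
  have hℓ20 : (0 : ℝ) < ((F.L : ℝ) ^ (K - n)) ^ 2 := by positivity
  -- the pure `LINE` family of a direction `A` (✓`Prop7TrueLinIterDefect`), as a `Nat.rec`
  let Sf : (PBond (F.P K) 0 → Matrix (Fin 2) (Fin 2) ℂ) → (k : ℕ) → PBond (F.P K) k → Matrix (Fin 2) (Fin 2) ℂ := fun A k =>
    Nat.rec (motive := fun k => PBond (F.P K) k → Matrix (Fin 2) (Fin 2) ℂ) A
      (fun k Sk => fun c => ((Fintype.card (Idx (F.P K)) : ℂ))⁻¹ • ∑ i : Idx (F.P K),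
          (((holAt (Averaging.iter (fun i => blockAvg (P := F.P K) (j := i) (expMeanLogSU (n := Fin 2))) k W) (walk (emb c.src) (stairWord i.2.1 (off i.1))) : Matrix.specialUnitaryGroup (Fin 2) ℂ) : Matrix (Fin 2) (Fin 2) ℂ) *
            covWalkSum (Averaging.iter (fun i => blockAvg (P := F.P K) (j := i) (expMeanLogSU (n := Fin 2))) k W) (Sk)
              (walk (walkEnd (emb c.src) (stairWord i.2.1 (off i.1))) (List.replicate (F.P K).L (c.dir, true))) *
          star ((holAt (Averaging.iter (fun i => blockAvg (P := F.P K) (j := i) (expMeanLogSU (n := Fin 2))) k W) (walk (emb c.src) (stairWord i.2.1 (off i.1))) : Matrix.specialUnitaryGroup (Fin 2) ℂ) : Matrix (Fin 2) (Fin 2) ℂ))) k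
  -- the true-linearisation family (✓`Prop7TrueLinIterStructure`), as a `Nat.rec`
  let Qf : (k : ℕ) → (PBond (F.P K) 0 → Matrix (Fin 2) (Fin 2) ℂ) → PBond (F.P K) k → Matrix (Fin 2) (Fin 2) ℂ := fun k =>
    Nat.rec (motive := fun k => (PBond (F.P K) 0 → Matrix (Fin 2) (Fin 2) ℂ) → PBond (F.P K) k → Matrix (Fin 2) (Fin 2) ℂ) (fun Y => Y)
      (fun k Qk => fun Y c => fderiv ℂ (eml : (Idx (F.P K) → Matrix (Fin 2) (Fin 2) ℂ) → Matrix (Fin 2) (Fin 2) ℂ)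
            (fun i => ((loopHol (Averaging.iter (fun i => blockAvg (P := F.P K) (j := i) (expMeanLogSU (n := Fin 2))) k W) c i : Matrix.specialUnitaryGroup (Fin 2) ℂ) : Matrix (Fin 2) (Fin 2) ℂ))
            (fun i => covWalkSum (Averaging.iter (fun i => blockAvg (P := F.P K) (j := i) (expMeanLogSU (n := Fin 2))) k W) (Qk Y)
                (walk (emb c.src) (loopWord (F.P K).L c.dir (off i.1) i.2.1 i.2.2))
              * ((loopHol (Averaging.iter (fun i => blockAvg (P := F.P K) (j := i) (expMeanLogSU (n := Fin 2))) k W) c i : Matrix.specialUnitaryGroup (Fin 2) ℂ) : Matrix (Fin 2) (Fin 2) ℂ))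
            * star ((corr (expMeanLogSU (n := Fin 2)) (Averaging.iter (fun i => blockAvg (P := F.P K) (j := i) (expMeanLogSU (n := Fin 2))) k W) c : Matrix.specialUnitaryGroup (Fin 2) ℂ) : Matrix (Fin 2) (Fin 2) ℂ)
          + ((corr (expMeanLogSU (n := Fin 2)) (Averaging.iter (fun i => blockAvg (P := F.P K) (j := i) (expMeanLogSU (n := Fin 2))) k W) c : Matrix.specialUnitaryGroup (Fin 2) ℂ) : Matrix (Fin 2) (Fin 2) ℂ)
            * covWalkSum (Averaging.iter (fun i => blockAvg (P := F.P K) (j := i) (expMeanLogSU (n := Fin 2))) k W) (Qk Y)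
                (walk (emb c.src) (List.replicate (F.P K).L (c.dir, true)))
            * star ((corr (expMeanLogSU (n := Fin 2)) (Averaging.iter (fun i => blockAvg (P := F.P K) (j := i) (expMeanLogSU (n := Fin 2))) k W) c : Matrix.specialUnitaryGroup (Fin 2) ℂ) : Matrix (Fin 2) (Fin 2) ℂ)) k
  have hQ0 : ∀ Y, Qf 0 Y = Y := fun _ => rfl
  have hQs : ∀ (k : ℕ) (Y : PBond (F.P K) 0 → Matrix (Fin 2) (Fin 2) ℂ) (c : PBond (F.P K) (k + 1)), Qf (k + 1) Y c
      = fderiv ℂ (eml : (Idx (F.P K) → Matrix (Fin 2) (Fin 2) ℂ) → Matrix (Fin 2) (Fin 2) ℂ)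
            (fun i => ((loopHol (Averaging.iter (fun i => blockAvg (P := F.P K) (j := i) (expMeanLogSU (n := Fin 2))) k W) c i : Matrix.specialUnitaryGroup (Fin 2) ℂ) : Matrix (Fin 2) (Fin 2) ℂ))
            (fun i => covWalkSum (Averaging.iter (fun i => blockAvg (P := F.P K) (j := i) (expMeanLogSU (n := Fin 2))) k W) (Qf k Y)
                (walk (emb c.src) (loopWord (F.P K).L c.dir (off i.1) i.2.1 i.2.2))
              * ((loopHol (Averaging.iter (fun i => blockAvg (P := F.P K) (j := i) (expMeanLogSU (n := Fin 2))) k W) c i : Matrix.specialUnitaryGroup (Fin 2) ℂ) : Matrix (Fin 2) (Fin 2) ℂ))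
            * star ((corr (expMeanLogSU (n := Fin 2)) (Averaging.iter (fun i => blockAvg (P := F.P K) (j := i) (expMeanLogSU (n := Fin 2))) k W) c : Matrix.specialUnitaryGroup (Fin 2) ℂ) : Matrix (Fin 2) (Fin 2) ℂ)
          + ((corr (expMeanLogSU (n := Fin 2)) (Averaging.iter (fun i => blockAvg (P := F.P K) (j := i) (expMeanLogSU (n := Fin 2))) k W) c : Matrix.specialUnitaryGroup (Fin 2) ℂ) : Matrix (Fin 2) (Fin 2) ℂ)
            * covWalkSum (Averaging.iter (fun i => blockAvg (P := F.P K) (j := i) (expMeanLogSU (n := Fin 2))) k W) (Qf k Y)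
                (walk (emb c.src) (List.replicate (F.P K).L (c.dir, true)))
            * star ((corr (expMeanLogSU (n := Fin 2)) (Averaging.iter (fun i => blockAvg (P := F.P K) (j := i) (expMeanLogSU (n := Fin 2))) k W) c : Matrix.specialUnitaryGroup (Fin 2) ℂ) : Matrix (Fin 2) (Fin 2) ℂ) := fun _ _ _ => rfl
  -- the stair-mean coarse gauges of every direction
  choose Λf hΛ0 hΛs using fun A : PBond (F.P K) 0 → Matrix (Fin 2) (Fin 2) ℂ => exists_stairGauge_family F (K := K) W A
  -- the frame-reduced response and the unitary frame
  let Gf : (PBond (F.P K) 0 → Matrix (Fin 2) (Fin 2) ℂ) → PBond (F.P K) (K - n) → Matrix (Fin 2) (Fin 2) ℂ := fun A c =>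
    ((fderiv ℂ (fun t : PBond (F.P K) 0 → Matrix (Fin 2) (Fin 2) ℂ =>
                (((emlIterU (K - n) (fun b' => expUnit (t b') * bgUnits F K W b') c : (Matrix (Fin 2) (Fin 2) ℂ)ˣ) : Matrix (Fin 2) (Fin 2) ℂ))) 0 A
              * star ((Averaging.iter (fun i => blockAvg (P := F.P K) (j := i) (expMeanLogSU (n := Fin 2))) (K - n) W c : Matrix.specialUnitaryGroup (Fin 2) ℂ) : Matrix (Fin 2) (Fin 2) ℂ))
          - (Λf A (K - n) c.src - ((Averaging.iter (fun i => blockAvg (P := F.P K) (j := i) (expMeanLogSU (n := Fin 2))) (K - n) W c : Matrix.specialUnitaryGroup (Fin 2) ℂ) : Matrix (Fin 2) (Fin 2) ℂ) * Λf A (K - n) c.tgt * star ((Averaging.iter (fun i => blockAvg (P := F.P K) (j := i) (expMeanLogSU (n := Fin 2))) (K - n) W c : Matrix.specialUnitaryGroup (Fin 2) ℂ) : Matrix (Fin 2) (Fin 2) ℂ)))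
  let Φ : PBond (F.P K) (K - n) → (Matrix (Fin 2) (Fin 2) ℂ)ˣ := fun c =>
    axialT (unitsField (toUField W)) (Site.fibreSite 0 (K - n) c.src fun _ => ⟨0, pow_pos (F.P K).L_pos (K - n)⟩) (embIter (K - n) c.src)
  have hΦ : ∀ c, Φ c ∈ unitaryUnits (Matrix (Fin 2) (Fin 2) ℂ) := fun c => axialT_bg_mem_unitaryUnits F W _ _
  -- the constants
  set ρ : ℝ := Real.sqrt ((((F.P K).L : ℝ) ^ (F.P K).d)⁻¹ * ((F.P K).L : ℝ) ^ 2) with hρ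
  set κ : ℝ := (159 * ((((F.P K).d + 2) * (F.P K).L : ℕ) : ℝ) * Real.sqrt (2 * (F.P K).d * ((F.P K).L : ℝ) ^ (F.P K).d * (2 * (F.P K).d))) with hκ
  set B : ℝ := (((((F.P K).d + 2) * (F.P K).L : ℕ) : ℝ) ^ 2 / 16 * ε₀) with hB
  set E₁ : ℝ := 2 * (10 ^ 9 * (F.L : ℝ) ^ 4 * ε₀ ^ 2 * ((((F.L : ℝ) ^ (K - n)) ^ (F.P K).d) * (((F.L : ℝ) ^ (K - n)) ^ 2))) with hE₁
  set E₂ : ℝ := 2 * (ρ⁻¹ * (ρ ^ (K - n) * κ * B * Real.exp (κ / ρ * B))) ^ 2 with hE₂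
  have hE₁0 : 0 ≤ E₁ := by rw [hE₁]; positivity
  have hE₂0 : 0 ≤ E₂ := by rw [hE₂]; positivity
  have hρ0 : 0 < ρ := by
    rw [hρ]; exact Real.sqrt_pos.mpr (by have := (F.P K).L_pos; positivity)
  -- (R1) = (iv) [✓p748544]
  have hR1 : ∀ A : PBond (F.P K) 0 → Matrix (Fin 2) (Fin 2) ℂ, (∀ b, (A b)ᴴ = -A b) → (∀ b, (A b).trace = 0) →
      ∑ c : PBond (F.P K) (K - n), ‖(frobEquiv.symm ((∑ r : Fin (F.P K).d → Fin ((F.P K).L ^ (K - n)), ∑ t ∈ range ((F.P K).L ^ (K - n)),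
        conjR (holT (unitsField (toUField W)) (Site.fibreSite 0 (K - n) c.src fun _ => ⟨0, pow_pos (F.P K).L_pos (K - n)⟩)
              (treeWord fun ν => ((r ν : ℕ) : ℤ))
            * holT (unitsField (toUField W)) (Site.fibreSite 0 (K - n) c.src r) (List.replicate t (c.dir, true)))
          (A ⟨(fun z : Site (F.P K) 0 => z.shift c.dir)^[t] (Site.fibreSite 0 (K - n) c.src r), c.dir⟩))
        - ((((F.L : ℝ) ^ (K - n)) ^ (F.P K).d : ℝ) : ℂ) • conjR (Φ c) (Sf A (K - n) c)) : W₂)‖ ^ 2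
      ≤ E₁ * ∑ b : PBond (F.P K) 0, ‖(frobEquiv.symm (A b) : W₂)‖ ^ 2 :=
    fun A _ _ => sum_frob_tubeStr_sub_smul_conjR_lineIter_le F hε₀ hε W hreg A (Sf A) (fun _ => rfl) (fun _ _ => rfl)
  -- (R2) = DEFECT via the stair bridge [✓p746096], squared, Frobenius letters
  have hR2 : ∀ A : PBond (F.P K) 0 → Matrix (Fin 2) (Fin 2) ℂ, (∀ b, (A b)ᴴ = -A b) → (∀ b, (A b).trace = 0) →
      ∑ c : PBond (F.P K) (K - n), ‖(frobEquiv.symm (Sf A (K - n) c - Gf A c) : W₂)‖ ^ 2 ≤ E₂ * ∑ b : PBond (F.P K) 0, ‖(frobEquiv.symm (A b) : W₂)‖ ^ 2 := by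
    intro A hsk htr
    have hA : ∀ b, A b ∈ skewAdjoint (Matrix (Fin 2) (Fin 2) ℂ) := fun b => by rw [skewAdjoint.mem_iff]; exact hsk b
    obtain ⟨h1, -⟩ := sqrt_sum_normSq_frameReduced_sub_lineIter_le_of_regPr F hε₀ hε hε12 W hreg Qf hQ0 hQs A hA htr (Λf A) (hΛ0 A)
      (fun k _ y => hΛs A k y) (Sf A) (fun _ => rfl) (fun _ _ => rfl) (k := K - n) le_rfl
    -- `h1 : ρ·√(Σ‖G − S‖²) ≤ ρ^{K−n}·κBe^{κB∕ρ}·√(Σ‖A‖²)`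
    rw [← hρ, ← hκ, ← hB] at h1
    have hS2 : 0 ≤ ∑ c : PBond (F.P K) (K - n), ‖Gf A c - Sf A (K - n) c‖ ^ 2 := by positivity
    have hA2 : 0 ≤ ∑ b : PBond (F.P K) 0, ‖A b‖ ^ 2 := by positivity
    have h2 : Real.sqrt (∑ c : PBond (F.P K) (K - n), ‖Gf A c - Sf A (K - n) c‖ ^ 2)
        ≤ (ρ⁻¹ * (ρ ^ (K - n) * κ * B * Real.exp (κ / ρ * B))) * Real.sqrt (∑ b : PBond (F.P K) 0, ‖A b‖ ^ 2) := by
      have h := mul_le_mul_of_nonneg_left h1 (inv_nonneg.mpr hρ0.le)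
      rw [← mul_assoc, inv_mul_cancel₀ hρ0.ne', one_mul, ← mul_assoc] at h
      exact h
    have h3 := pow_le_pow_left₀ (Real.sqrt_nonneg _) h2 2
    rw [Real.sq_sqrt hS2, mul_pow, Real.sq_sqrt hA2] at h3
    have h4 : ∑ c : PBond (F.P K) (K - n), ‖(frobEquiv.symm (Sf A (K - n) c - Gf A c) : W₂)‖ ^ 2
        ≤ 2 * ∑ c : PBond (F.P K) (K - n), ‖Sf A (K - n) c - Gf A c‖ ^ 2 :=
      sum_frob_le_two_mul_sum_opNorm_sq (fun c => Sf A (K - n) c - Gf A c)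
    have h5 : ∑ c : PBond (F.P K) (K - n), ‖Sf A (K - n) c - Gf A c‖ ^ 2 = ∑ c : PBond (F.P K) (K - n), ‖Gf A c - Sf A (K - n) c‖ ^ 2 :=
      Finset.sum_congr rfl fun c _ => by rw [norm_sub_rev]
    have h6 : ∑ b : PBond (F.P K) 0, ‖A b‖ ^ 2 ≤ ∑ b : PBond (F.P K) 0, ‖(frobEquiv.symm (A b) : W₂)‖ ^ 2 := sum_opNorm_sq_le_sum_frob A
    have h7 : 0 ≤ (ρ⁻¹ * (ρ ^ (K - n) * κ * B * Real.exp (κ / ρ * B))) ^ 2 := sq_nonneg _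
    rw [h5] at h4
    rw [hE₂]
    nlinarith [h4, h3, mul_le_mul_of_nonneg_left h6 h7]
  -- (R3) = LEG ⊕ STRUCTURE ⊕ the coarse-gauge identity [px13 g11]
  have hR3 : ∀ A : PBond (F.P K) 0 → Matrix (Fin 2) (Fin 2) ℂ, (∀ b, (A b)ᴴ = -A b) → (∀ b, (A b).trace = 0) →
      ∀ c' : PBond (F.P n) 0, QTwS F n K h W A c' = Gf A (bondShift (sites_eq F n K h) c') := by
    intro A hsk htr c'
    have hA : ∀ b, A b ∈ skewAdjoint (Matrix (Fin 2) (Fin 2) ℂ) := fun b => by rw [skewAdjoint.mem_iff]; exact hsk b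
    exact QTwS_apply_eq_frameReduced_bondShift F h hε₀ hε hε12 W hreg Qf hQ0 hQs A hA htr (Λf A) (hΛ0 A) (fun k _ y => hΛs A k y) c'
  -- ★ the knit
  have hmain := tubeRowC_of_su2Rows F n K h hε₀ hε12 W hreg (fun A c => Sf A (K - n) c) Gf Φ hΦ hE₁0 hE₂0 hR1 hR2 hR3 X
  refine hmain.trans (add_le_add le_rfl ?_)
  have hX0 : 0 ≤ ∑ b : PBond (F.P K) 0, ‖X b‖ ^ 2 := by positivity
  refine mul_le_mul_of_nonneg_right (mul_le_mul_of_nonneg_right (mul_le_mul_of_nonneg_right ?_ (sq_nonneg _)) (by positivity)) hX0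
  -- the slack constant
  rw [div_le_iff₀ (by positivity), hE₂, hE₁]
  have hb := bridgeConst_sq_le F n K hε₀ hε
  rw [← hρ, ← hκ, ← hB] at hb
  linarith [hb]

/-- ★★ **THE `hT` BINDER OF THE ROUTE-R ASSEMBLY AT EVERY PRINTED-REGULAR BACKGROUND** (`CT = 4`, `Cq = 10¹¹L¹⁰`): ✓`Prop7TransverseRowOfTubeRowRegPr.hT_of_tubeRowC` fed with §2
and the window §1 — `(1 − 16·10¹¹L¹⁰ε₀² − 37044ε₀)∕36·‖Y‖² ≤ Re⟪Y, Δ_η Y⟫ + (8∕9)·4·(c₀∕cB)·ℓ^d·‖Q_k Y‖²` on `ker d*`.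
[cite: Balaban1985BackgroundPropagators, Thm 3.11 p.416, (3.118)-(3.122) pp.419-420] -/
theorem hT_of_regPr (c₀ cB : ℝ) [Fact (0 < c₀)] [Fact (0 < cB)] {ε₀ : ℝ} (hε₀ : 0 < ε₀) (hε : 10 ^ 10 * (F.L : ℝ) ^ 6 * ε₀ ≤ 1)
    (hε12 : 10 ^ 12 * (F.L : ℝ) ^ 3 * ε₀ ≤ 1)
    (W : GaugeField (F.P K) 0 (Matrix.specialUnitaryGroup (Fin 2) ℂ)) (hreg : RegPr F n K ε₀ W) :
    ∀ Y : BondL2K ℂ 3 (periodsT3 F K) c₀ W₂, DstarL2 F n K c₀ W Y = 0 →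
      (1 - 16 * (10 ^ 11 * (F.L : ℝ) ^ 10) * ε₀ ^ 2 - 37044 * ε₀) / 36 * ‖Y‖ ^ 2
        ≤ RCLike.re ⟪Y, DeltaEta F n K c₀ W Y⟫_ℂ + 8 / 9 * 4 * (c₀ / cB) * ((F.L : ℝ) ^ (K - n)) ^ (F.P K).d * ‖Qk F n K h c₀ cB W Y‖ ^ 2 := by
  have hε1 : 216 * ε₀ ≤ 1 := by
    have hL3 : (3 : ℝ) ≤ F.L := by
      have h3 : 3 ≤ F.L := by obtain ⟨a, ha⟩ := F.hL.1; have := F.hL.2; omega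
      exact_mod_cast h3
    have h1 : (216 : ℝ) ≤ 10 ^ 10 * (F.L : ℝ) ^ 6 := by
      have : (3 : ℝ) ^ 6 ≤ (F.L : ℝ) ^ 6 := pow_le_pow_left₀ (by norm_num) hL3 6
      nlinarith
    nlinarith [hε₀.le]
  exact hT_of_tubeRowC F n K h c₀ cB hε₀.le hε1 W hreg (by norm_num : (0 : ℝ) ≤ 4)
    (sixteen_mul_Cq_mul_sq_le_one F hε₀ hε) (tubeRowC_of_regPr F n K h hε₀ hε hε12 W hreg)

end Summit.QuantumFields.YangMills.Theorems.Prop7TubeComparisonKnitOfRegPr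

end
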